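import Summits.Schanuel.Schanuel.Theorems.RootDecomp1KKummerClosure05

/-!
# RootDecomp1KKummerClosure («KUMMER CLOSURE», lens 6 gen 12/13 = 1K ROUND 9) — continuation (RootDecomp1KKummerClosureCells): §K7 THE LOG CELLS of A₄ʰ 33363 at every anchor λ ∈ exp⁻¹(ℚ̄^× ∖ μ_∞): hyperCell_logAlg_any (mod hNW), the two _live forms, hyperCell_log_any_of_W78, flagship algebraicIndependent_log_rpow

Part of the six-file split (400-line rule) of lens 6's node «KUMMER CLOSURE» = HOME/decomp-schanuel-lens-6/g13/addendum/KummerClosure.lean (v2, sha256 6dd432d1…, 1650 l;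
= g12 v1 6d5e0790… with the engine re-cut into engine_lower / engine_upper at the census's request, every statement byte-identical; 1K ROUND 9 THEOREM ROUND on the critic's
round-9 ACCEPTED-NEXT (i‴) «general Kummer closure with the UNIFORM degree bound»; `--supports stmt-Schanuel-33363`). Shared namespace
`Summit.Schanuel.Schanuel.Theorems.RootDecomp1KKummerClosure`; the node docstring is in part 01; K4's one-line copies of tree-private lemmas are private here.
Facts enter as hypotheses only (hNW : NesterenkoWaldschmidt1996_thm_1, hlm : Literature.Uncategorized.W78LogMeasure). Sorry-free; standard axioms. Nothing here proves Schanuel; rung 0.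
-/

open Polynomial Complex IntermediateField
open Summit.Schanuel.Schanuel.Theorems.RootDecomp1KHyper
open Summit.Schanuel.Schanuel.Theorems.RootDecomp1KHyper.HyperCell
open Summit.Schanuel.Schanuel.Theorems.RootDecomp1KRadical

noncomputable section

namespace Summit.Schanuel.Schanuel.Theorems.RootDecomp1KKummerClosure

/-! ## K7. THE LOG CELLS of A₄ʰ at every anchor `λ ∈ exp⁻¹(ℚ̄^× ∖ μ_∞)` and the flagship -/

section LogCells
open Literature.NumberTheory.Transcendental

/-- `SB N z` (`N ≤ 3`) as soon as `ℚ(z, e^z, i)` contains `ρ', λ, e^{λρ'}` for a hyper-Liouville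
`ρ' > 0` and an anchor `λ` of finite transcendence type with `e^λ ∈ ℚ̄^× ∖ μ_∞`. -/
theorem sb_logCell_of_mem {lam : ℂ} (hft : FiniteTranscendenceType lam)
    (hαalg : IsAlgebraic ℚ (cexp lam)) (htor : ∀ n : ℕ, 0 < n → cexp lam ^ n ≠ 1) {ρ' : ℝ}
    (hρ' : HyperLiouville ρ') (hρ'0 : 0 < ρ') {N : ℕ} (hN : N ≤ 3) {z : Fin N → ℂ}
    (h0 : (ρ' : ℂ) ∈ adjoin ℚ (SFset z ∪ {I})) (h1 : lam ∈ adjoin ℚ (SFset z ∪ {I}))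
    (h2 : cexp (lam * (ρ' : ℂ)) ∈ adjoin ℚ (SFset z ∪ {I})) : SB N z := by
  refine sb_of_algebraicIndependent (algebraicIndependent_logCell rfl hft hαalg htor hρ' hρ'0)
    (by simpa using hN) fun j => ?_
  fin_cases j
  · exact h0
  · exact h1
  · exact h2

/-- **LOG CELLS at every anchor `λ` with `e^λ ∈ ℚ̄^× ∖ μ_∞`** (kernel, mod a finite transcendence
type for the non-zero logarithms of algebraic numbers — supplied below by NW 1996 Thm 1, or by
W78 Cor. 3.7).  For a hyper-Liouville `ρ` and ANY `w`: the pair `(λ, ρλ)` and the triple `(λ, ρλ, w)`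
are `HyperLinLiouville` and satisfy `SB 2`, `SB 3` — via the triple `(ρ', λ', e^{λ'ρ'})`,
`ρ' = ερ > 0`, `λ' = ελ` (`ε = ±1`; `e^{λ'} = α^{±1}` is again algebraic and non-torsion):
`ℚ(z, e^z, i) ∋ λ' = εz₀`, `ρ' = εz₁/z₀`, `e^{λ'ρ'} = e^{z₁}`. -/
theorem hyperCell_log_any
    (hFT : ∀ μ : ℂ, μ ≠ 0 → IsAlgebraic ℚ (cexp μ) → FiniteTranscendenceType μ)
    {lam : ℂ} (hαalg : IsAlgebraic ℚ (cexp lam)) (htor : ∀ n : ℕ, 0 < n → cexp lam ^ n ≠ 1)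
    {ρ : ℝ} (hρ : HyperLiouville ρ) (w : ℂ) :
    HyperLinLiouville ![lam, (ρ : ℂ) * lam, w] ∧ SB 2 ![lam, (ρ : ℂ) * lam] ∧
      SB 3 ![lam, (ρ : ℂ) * lam, w] := by
  have hl0 : lam ≠ 0 := by
    rintro rfl; exact htor 1 one_pos (by rw [Complex.exp_zero, one_pow])
  have hρ0 : ρ ≠ 0 := hρ.ne_zero
  -- sign normalisation `ρ' = ερ > 0`
  obtain ⟨ε, hε1, hpos⟩ : ∃ ε : ℝ, (ε = 1 ∨ ε = -1) ∧ 0 < ε * ρ := by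
    rcases lt_or_gt_of_ne hρ0 with h | h
    · exact ⟨-1, Or.inr rfl, by linarith⟩
    · exact ⟨1, Or.inl rfl, by linarith⟩
  have hρ' : HyperLiouville (ε * ρ) := by
    rcases hε1 with rfl | rfl
    · simpa using hρ
    · simpa using hρ.neg
  have hεC0 : (ε : ℂ) ≠ 0 := by
    rcases hε1 with rfl | rfl <;> norm_num
  have hε2 : (ε : ℂ) * (ε : ℂ) = 1 := by
    rcases hε1 with rfl | rfl <;> push_cast <;> norm_num
  -- the anchor fed to the engine: `λ' = ελ`, `e^{λ'} = (e^λ)^{±1}`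
  obtain ⟨lam', hlam'⟩ : ∃ lam' : ℂ, lam' = (ε : ℂ) * lam := ⟨_, rfl⟩
  have hl'0 : lam' ≠ 0 := hlam' ▸ mul_ne_zero hεC0 hl0
  have hexp' : cexp lam' = cexp lam ∨ cexp lam' = (cexp lam)⁻¹ := by
    rcases hε1 with rfl | rfl
    · left; rw [hlam']; push_cast; rw [one_mul]
    · right; rw [hlam', ← Complex.exp_neg]; congr 1; push_cast; ring
  have hαalg' : IsAlgebraic ℚ (cexp lam') := by
    rcases hexp' with h | h
    · rw [h]; exact hαalg
    · rw [h]; exact hαalg.inv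
  have htor' : ∀ n : ℕ, 0 < n → cexp lam' ^ n ≠ 1 := by
    intro n hn
    rcases hexp' with h | h
    · rw [h]; exact htor n hn
    · rw [h, inv_pow]; intro h1; exact htor n hn (inv_eq_one.mp h1)
  have hft' : FiniteTranscendenceType lam' := hFT lam' hl'0 hαalg'
  have key : ∀ F : IntermediateField ℚ ℂ, lam ∈ F → (ρ : ℂ) * lam ∈ F →
      cexp ((ρ : ℂ) * lam) ∈ F →
      (((ε * ρ : ℝ)) : ℂ) ∈ F ∧ lam' ∈ F ∧ cexp (lam' * (((ε * ρ : ℝ)) : ℂ)) ∈ F := by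
    intro F hz0 hz1 he1
    have hεF : (ε : ℂ) ∈ F := by
      rcases hε1 with rfl | rfl
      · push_cast; exact F.one_mem
      · push_cast; exact F.neg_mem F.one_mem
    have hρmem : (ρ : ℂ) ∈ F := by
      have hdiv := div_mem hz1 hz0
      rwa [mul_div_assoc, div_self hl0, mul_one] at hdiv
    refine ⟨?_, ?_, ?_⟩
    · push_cast; exact mul_mem hεF hρmem
    · rw [hlam']; exact mul_mem hεF hz0
    · have e : lam' * (((ε * ρ : ℝ)) : ℂ) = (ρ : ℂ) * lam := by
        rw [hlam']; push_cast; linear_combination (ρ : ℂ) * lam * hε2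
      rw [e]; exact he1
  refine ⟨?_, ?_, ?_⟩
  · refine hyperLinLiouville_of_prefix (k := 2) (by omega) ?_
    have h2 : (fun i : Fin 2 => (![lam, (ρ : ℂ) * lam, w] : Fin 3 → ℂ)
        (Fin.castLE (show 2 ≤ 3 by omega) i)) = ![lam, (ρ : ℂ) * lam] := by
      funext i; fin_cases i <;> rfl
    rw [h2]; exact hyperLinLiouville_of_hyperLiouville_ratio hρ _
  · obtain ⟨h0, h1, h2⟩ := key (adjoin ℚ (SFset ![lam, (ρ : ℂ) * lam] ∪ {I}))
      (mem_adjoin_SFset_I' (Or.inl ⟨0, rfl⟩)) (mem_adjoin_SFset_I' (Or.inl ⟨1, rfl⟩))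
      (mem_adjoin_SFset_I' (Or.inr ⟨1, rfl⟩))
    exact sb_logCell_of_mem hft' hαalg' htor' hρ' hpos (by omega) h0 h1 h2
  · obtain ⟨h0, h1, h2⟩ := key (adjoin ℚ (SFset ![lam, (ρ : ℂ) * lam, w] ∪ {I}))
      (mem_adjoin_SFset_I' (Or.inl ⟨0, rfl⟩)) (mem_adjoin_SFset_I' (Or.inl ⟨1, rfl⟩))
      (mem_adjoin_SFset_I' (Or.inr ⟨1, rfl⟩))
    exact sb_logCell_of_mem hft' hαalg' htor' hρ' hpos le_rfl h0 h1 h2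

/-- **LOG CELLS mod NW 1996 Theorem 1 ALONE** (the registered Literature fact): for every `λ` with
`e^λ ∈ ℚ̄^× ∖ μ_∞`, every hyper-Liouville `ρ` and any `w`. -/
theorem hyperCell_log_any_of_NW1996Thm1 (hNW : NesterenkoWaldschmidt1996_thm_1) {lam : ℂ}
    (hαalg : IsAlgebraic ℚ (cexp lam)) (htor : ∀ n : ℕ, 0 < n → cexp lam ^ n ≠ 1) {ρ : ℝ}
    (hρ : HyperLiouville ρ) (w : ℂ) :
    HyperLinLiouville ![lam, (ρ : ℂ) * lam, w] ∧ SB 2 ![lam, (ρ : ℂ) * lam] ∧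
      SB 3 ![lam, (ρ : ℂ) * lam, w] :=
  hyperCell_log_any (fun _ h0 halg => finiteTranscendenceType_log hNW h0 halg) hαalg htor hρ w

/-- **LOG CELLS mod W78 Cor. 3.7** (`W78LogMeasure`, vendored hypothesis) — the same cells from the
older, weaker measure (any finite transcendence type suffices). -/
theorem hyperCell_log_any_of_W78 (hlm : Literature.Uncategorized.W78LogMeasure) {lam : ℂ}
    (hαalg : IsAlgebraic ℚ (cexp lam)) (htor : ∀ n : ℕ, 0 < n → cexp lam ^ n ≠ 1) {ρ : ℝ}
    (hρ : HyperLiouville ρ) (w : ℂ) :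
    HyperLinLiouville ![lam, (ρ : ℂ) * lam, w] ∧ SB 2 ![lam, (ρ : ℂ) * lam] ∧
      SB 3 ![lam, (ρ : ℂ) * lam, w] :=
  hyperCell_log_any (fun _ h0 halg => finiteTranscendenceType_log_of_W78 hlm h0 halg) hαalg htor hρ w

/-- Live-text form of the log PAIR cell (the conclusion of A₄ʰ, 33363, at `n = 2`, anchor `λ`,
`e^λ ∈ ℚ̄^× ∖ μ_∞`), mod NW 1996 Thm 1 — A₄ʰ's two hypotheses are not used. -/
theorem hyperCell_log_pair_live (hNW : NesterenkoWaldschmidt1996_thm_1) {lam : ℂ}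
    (hαalg : IsAlgebraic ℚ (cexp lam)) (htor : ∀ n : ℕ, 0 < n → cexp lam ^ n ≠ 1) {ρ : ℝ}
    (hρ : HyperLiouville ρ) :
    (2 : Cardinal) ≤ Algebra.trdeg ℚ ↥(IntermediateField.adjoin ℚ
      (Set.range ![lam, (ρ : ℂ) * lam] ∪ Set.range (Complex.exp ∘ ![lam, (ρ : ℂ) * lam]))) :=
  (hyperCell_log_any_of_NW1996Thm1 hNW hαalg htor hρ 0).2.1

/-- The instance of A₄ʰ's body (live text, `n = 3`) at the log triple cells `(λ, ρλ, w)`,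
`e^λ ∈ ℚ̄^× ∖ μ_∞`, mod NW 1996 Thm 1 — both hypotheses of A₄ʰ idle. -/
theorem hyperLiouvilleSchanuel_live_at_logCell (hNW : NesterenkoWaldschmidt1996_thm_1) {lam : ℂ}
    (hαalg : IsAlgebraic ℚ (cexp lam)) (htor : ∀ n : ℕ, 0 < n → cexp lam ^ n ≠ 1) {ρ : ℝ}
    (hρ : HyperLiouville ρ) (w : ℂ) :
    LinearIndependent ℚ ![lam, (ρ : ℂ) * lam, w] →
    (∀ m : ℕ, ∃ h : Fin 3 → ℤ, h ≠ 0 ∧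
      ‖∑ i, (h i : ℂ) * ![lam, (ρ : ℂ) * lam, w] i‖ < Real.exp (-((1 + ∑ i, (|h i| : ℝ)) ^ m))) →
    ((3 : ℕ) : Cardinal) ≤ Algebra.trdeg ℚ ↥(IntermediateField.adjoin ℚ
      (Set.range ![lam, (ρ : ℂ) * lam, w] ∪ Set.range (Complex.exp ∘ ![lam, (ρ : ℂ) * lam, w]))) :=
  fun _ _ => (hyperCell_log_any_of_NW1996Thm1 hNW hαalg htor hρ w).2.2

/-- **THE KUMMER CLOSURE — the line-cells of A₄ʰ at EVERY non-zero logarithm of an algebraic number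
(mod NW 1996 Theorem 1 alone).**  For `u ≠ 0` with `e^u ∈ ℚ̄`, every hyper-Liouville `ρ` and any `w`:
`(u, ρu, w)` is `HyperLinLiouville`, `SB 2 (u, ρu)`, `SB 3 (u, ρu, w)`.  Torsion anchors (`e^u ∈ μ_∞`, i.e.
`u ∈ ℚ^×·πi`) are the tree's HYPOTHESIS-FREE torsion cells `hyperCell_ratPiI_any`; all the others are the
log cells `hyperCell_log_any_of_NW1996Thm1` of this file. -/
theorem hyperCell_logAlg_any (hNW : NesterenkoWaldschmidt1996_thm_1) {u : ℂ} (hu0 : u ≠ 0)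
    (halg : IsAlgebraic ℚ (cexp u)) {ρ : ℝ} (hρ : HyperLiouville ρ) (w : ℂ) :
    HyperLinLiouville ![u, (ρ : ℂ) * u, w] ∧ SB 2 ![u, (ρ : ℂ) * u] ∧ SB 3 ![u, (ρ : ℂ) * u, w] := by
  by_cases htor : ∀ n : ℕ, 0 < n → cexp u ^ n ≠ 1
  · exact hyperCell_log_any_of_NW1996Thm1 hNW halg htor hρ w
  push Not at htor
  obtain ⟨n, hn, h1⟩ := htor
  rw [← Complex.exp_nat_mul] at h1
  obtain ⟨k, hk⟩ := Complex.exp_eq_one_iff.mp h1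
  have hnC : (n : ℂ) ≠ 0 := by exact_mod_cast hn.ne'
  have h2 : u * n = k * (2 * Real.pi * I) := by rw [mul_comm]; exact hk
  have h3 : u = k * (2 * Real.pi * I) / n := eq_div_of_mul_eq hnC h2
  have e : (((2 * k / n : ℚ)) : ℂ) = 2 * (k : ℂ) / (n : ℂ) := by push_cast; ring
  have hu : u = (((2 * k / n : ℚ)) : ℂ) * Real.pi * I := by rw [h3, e]; ring
  have hs : (2 * k / n : ℚ) ≠ 0 := by
    intro h0; apply hu0; rw [hu, h0]; simp
  subst hu
  exact hyperCell_ratPiI_any hρ hs w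

/-- The instance of A₄ʰ's body (live text, `n = 3`) at `(u, ρu, w)` for EVERY `u ≠ 0` with `e^u ∈ ℚ̄`
(mod NW 1996 Thm 1) — both hypotheses of A₄ʰ idle. -/
theorem hyperLiouvilleSchanuel_live_at_logAlgCell (hNW : NesterenkoWaldschmidt1996_thm_1) {u : ℂ}
    (hu0 : u ≠ 0) (halg : IsAlgebraic ℚ (cexp u)) {ρ : ℝ} (hρ : HyperLiouville ρ) (w : ℂ) :
    LinearIndependent ℚ ![u, (ρ : ℂ) * u, w] →
    (∀ m : ℕ, ∃ h : Fin 3 → ℤ, h ≠ 0 ∧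
      ‖∑ i, (h i : ℂ) * ![u, (ρ : ℂ) * u, w] i‖ < Real.exp (-((1 + ∑ i, (|h i| : ℝ)) ^ m))) →
    ((3 : ℕ) : Cardinal) ≤ Algebra.trdeg ℚ ↥(IntermediateField.adjoin ℚ
      (Set.range ![u, (ρ : ℂ) * u, w] ∪ Set.range (Complex.exp ∘ ![u, (ρ : ℂ) * u, w]))) :=
  fun _ _ => (hyperCell_logAlg_any hNW hu0 halg hρ w).2.2

/-- **By-product: anchors `log log α`.**  The gen-11 RADICAL cells (tree `hyperCell_radical_any`) on every
line `ℂ·u` whose exponential is a non-zero logarithm of an algebraic number (`e^{e^u} ∈ ℚ̄`; e.g. `u` = any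
determination of `log log α`, `α ∈ ℚ̄ ∖ {0, 1}`), mod NW96 Thm 1 — the base `e^u` now has finite transcendence
type by `finiteTranscendenceType_log`. -/
theorem hyperCell_loglog_any (hNW : NesterenkoWaldschmidt1996_thm_1) {u : ℂ} (hu0 : u ≠ 0)
    (halg : IsAlgebraic ℚ (cexp (cexp u))) {ρ : ℝ} (hρ : HyperLiouville ρ) (w : ℂ) :
    SB 2 ![u, (ρ : ℂ) * u] ∧ SB 3 ![u, (ρ : ℂ) * u, w] :=
  hyperCell_radical_any hu0 (finiteTranscendenceType_log hNW (Complex.exp_ne_zero u) halg) hρ w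

/-- **FLAGSHIP — the Gelfond–Kummer closure (mod NW 1996 Theorem 1 alone).** For every algebraic
`α ≠ 0` that is not a root of unity, EVERY determination `λ` of `log α`, and every hyper-Liouville real
`ρ > 0`: `ρ, λ, e^{λρ} (= α^ρ)` are algebraically independent over `ℚ`. -/
theorem algebraicIndependent_log_rpow (hNW : NesterenkoWaldschmidt1996_thm_1) {α lam : ℂ}
    (hlam : cexp lam = α) (hαalg : IsAlgebraic ℚ α) (htor : ∀ n : ℕ, 0 < n → α ^ n ≠ 1) {ρ : ℝ}
    (hρ : HyperLiouville ρ) (hρ0 : 0 < ρ) :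
    AlgebraicIndependent ℚ ![(ρ : ℂ), lam, cexp (lam * (ρ : ℂ))] := by
  have hl0 : lam ≠ 0 := by
    rintro rfl; apply htor 1 one_pos; rw [← hlam, Complex.exp_zero, one_pow]
  have halg' : IsAlgebraic ℚ (cexp lam) := by rw [hlam]; exact hαalg
  exact algebraicIndependent_logCell hlam (finiteTranscendenceType_log hNW hl0 halg') hαalg htor hρ hρ0

/-- The real form: for a real algebraic `a > 0`, `a ≠ 1` and a hyper-Liouville `ρ > 0`, the three
real numbers `ρ, log a, a^ρ` are algebraically independent over `ℚ` (mod NW 1996 Theorem 1). -/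
theorem algebraicIndependent_real_log_rpow (hNW : NesterenkoWaldschmidt1996_thm_1) {a : ℝ}
    (haalg : IsAlgebraic ℚ (a : ℂ)) (ha0 : 0 < a) (ha1 : a ≠ 1) {ρ : ℝ} (hρ : HyperLiouville ρ)
    (hρ0 : 0 < ρ) :
    AlgebraicIndependent ℚ ![(ρ : ℂ), ((Real.log a : ℝ) : ℂ), ((a ^ ρ : ℝ) : ℂ)] := by
  have hlam : cexp ((Real.log a : ℝ) : ℂ) = (a : ℂ) := by
    rw [← Complex.ofReal_exp, Real.exp_log ha0]
  have htor : ∀ n : ℕ, 0 < n → (a : ℂ) ^ n ≠ 1 := by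
    intro n hn h
    have h' : a ^ n = 1 := by exact_mod_cast h
    exact ha1 ((pow_eq_one_iff_of_nonneg ha0.le hn.ne').mp h')
  have e : ((a ^ ρ : ℝ) : ℂ) = cexp (((Real.log a : ℝ) : ℂ) * (ρ : ℂ)) := by
    rw [Real.rpow_def_of_pos ha0, Complex.ofReal_exp]; push_cast; ring_nf
  rw [e]
  exact algebraicIndependent_log_rpow hNW hlam haalg htor hρ hρ0

end LogCells

end Summit.Schanuel.Schanuel.Theorems.RootDecomp1KKummerClosure
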